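import Literature.Probability.Percolation.ArmSeparationOuter
import HarnessLib

/-!
# Outer separation of two arms: the failure event is unlikely and lives outside `Λ_M`

Topic: Probability / Percolation; family `crit-perc`. The probabilistic half of Kesten's
separation step for two arms on the hexagonal annulus `Λ_{2M} ∖ Λ_n` (companion of
`ArmSeparationOuter.lean`): the event `OutGood M T k₀ K ω` — none of the twelve rotated /
colour-exchanged configurations fails behind side `0` — satisfies

* `real_setOf_outFail_le` — `P_{1/2}(OutFail) ≤ (1 - c₄)^{T+1} + T (1 - c_F²)^K`
  (`real_trapSeparation_fail_le` of `ArmSeparationFenceBound.lean` and a union bound);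
* `real_setOf_not_outGood_le` — `P_{1/2}(¬ OutGood) ≤ 12 ((1 - c₄)^{T+1} + T (1 - c_F²)^K)`
  (rotation invariance `real_preimage_rotConfig` and colour-exchange invariance
  `sitePercolation_real_preimage_compl` of `P_{1/2}`): Nolin's "`(4δ)`" (2008, §4.4, proof of
  Thm. 11: "`P(A(2^k,2^K)) ≤ P(Ã^{·/η'}(2^k,2^K)) + (4δ) P(A(2^k,2^{K-1}))`", here twelve regions),
  with `δ → 0` as `T → ∞` then `K → ∞`;
* `determinedBy_setOf_outFail`, `determinedBy_setOf_not_outGood` — **locality**: these events are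
  determined by finitely many sites, all of norm `> M` (`outFailFinset`, `outGoodFinset`,
  `lt_triNorm_of_mem_outGoodFinset`), hence independent of every event inside `Λ_M` such as
  `armEvent κ n M` ("by independence of the two latter events", Nolin).

## References

* P. Nolin, *Near-critical percolation in two dimensions*, Electron. J. Probab. 13 (2008), §4.4,
  proof of Thm. 11 [arXiv 0711.4948: Thm. 10, Lemma 14]. [Nolin2008]
* H. Kesten, *Scaling relations for 2D-percolation*, Comm. Math. Phys. 109 (1987), Lemma 2. [Kesten1987]
-/

noncomputable section

open MeasureTheory Set

namespace Literature.Probability.Percolation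

open LatticeModels

/-! ### Probability of failure -/

/-- **`P_{1/2}(OutFail) ≤ (1 - c₄)^{T+1} + T (1 - c_F²)^K`** (`M ≥ 3`, `16 k + 1 ≤ M` for all
scales): the failure event is contained in `{lowestSeq T ≠ none} ∪ ⋃_{u<T} {TrapSeqFail u}`. [cite: Nolin2008, §4.4 Lemma 15 (arXiv 0711.4948: Lemma 14, (4.20))] -/
theorem real_setOf_outFail_le {cF c₄ : ℝ} (hcF : 0 < cF)
    (hF : ∀ (z : Site 2) (k : ℕ), 1 ≤ k → cF ≤ (triSitePercolation half).real (triFrameAt z k))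
    (hrsw : ∀ n : ℕ, 1 ≤ ⌊(4 : ℝ) * n⌋₊ → c₄ ≤ triLRCrossingProb half ⌊(4 : ℝ) * n⌋₊ n)
    {M T k₀ K : ℕ} (hM : 3 ≤ M) (hk₀ : 1 ≤ k₀) (hKM : ∀ j < K, 16 * (trapScale k₀ j : ℤ) + 1 ≤ M) :
    (triSitePercolation half).real {χ | OutFail M T k₀ K χ} ≤ (1 - c₄) ^ (T + 1) + T * (1 - cF ^ 2) ^ K := by
  have hsub : {χ | OutFail M T k₀ K χ} ⊆ {χ | (trapDomain M).lowestSeq χ T ≠ none} ∪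
      ⋃ u ∈ Finset.range T, {χ | TrapSeqFail M u k₀ K χ} := by
    rintro χ (h | ⟨u, hu, h⟩)
    · exact Or.inl h
    · refine Or.inr ?_
      simp only [Set.mem_iUnion, Set.mem_setOf_eq]
      exact ⟨u, Finset.mem_range.2 hu, h⟩
  refine (measureReal_mono hsub (measure_ne_top _ _)).trans ?_
  refine (measureReal_union_le _ _).trans ?_
  refine le_trans (add_le_add le_rfl (measureReal_biUnion_finset_le _ _)) ?_
  exact real_trapSeparation_fail_le hcF hF hrsw hM hk₀ hKM

/-- Failure in a rotated frame has the same probability. [folklore] -/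
theorem real_setOf_outFail_rotConfig (M T k₀ K i : ℕ) :
    (triSitePercolation half).real {ω | OutFail M T k₀ K (rotConfig i ω)} =
      (triSitePercolation half).real {χ | OutFail M T k₀ K χ} :=
  real_preimage_rotConfig half i {χ | OutFail M T k₀ K χ}

/-- Failure of the complementary colour in a rotated frame has the same probability (`p = 1/2`). [folklore] -/
theorem real_setOf_outFail_rotConfig_compl (M T k₀ K i : ℕ) :
    (triSitePercolation half).real {ω | OutFail M T k₀ K (rotConfig i ω)ᶜ} =
      (triSitePercolation half).real {χ | OutFail M T k₀ K χ} := by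
  have hset : {ω : SiteConfig (Site 2) | OutFail M T k₀ K (rotConfig i ω)ᶜ} =
      compl ⁻¹' (rotConfig i ⁻¹' {χ | OutFail M T k₀ K χ}) := by
    ext ω
    simp only [Set.mem_setOf_eq, Set.mem_preimage, rotConfig_compl]
  rw [hset]
  unfold triSitePercolation
  rw [sitePercolation_real_preimage_compl, symm_half]
  exact real_preimage_rotConfig half i {χ | OutFail M T k₀ K χ}

/-- **`P_{1/2}(¬ OutGood) ≤ 12 · P_{1/2}(OutFail)`**: union bound over the six frames and the two
colours. [cite: Nolin2008, §4.4 (arXiv 0711.4948: proof of Thm. 10, first step)] -/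
theorem real_setOf_not_outGood_le_mul (M T k₀ K : ℕ) :
    (triSitePercolation half).real {ω | ¬ OutGood M T k₀ K ω} ≤
      12 * (triSitePercolation half).real {χ | OutFail M T k₀ K χ} := by
  set μ := triSitePercolation half with hμ
  have hsub : {ω | ¬ OutGood M T k₀ K ω} ⊆ ⋃ i ∈ Finset.range 6,
      ({ω | OutFail M T k₀ K (rotConfig i ω)} ∪ {ω | OutFail M T k₀ K (rotConfig i ω)ᶜ}) := by
    intro ω hω
    simp only [OutGood, Set.mem_setOf_eq, not_forall, not_and_or, not_not, exists_prop] at hω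
    obtain ⟨i, hi, h⟩ := hω
    simp only [Set.mem_iUnion, Set.mem_union, Set.mem_setOf_eq]
    exact ⟨i, Finset.mem_range.2 hi, h⟩
  calc μ.real {ω | ¬ OutGood M T k₀ K ω}
      ≤ μ.real (⋃ i ∈ Finset.range 6, ({ω | OutFail M T k₀ K (rotConfig i ω)} ∪ {ω | OutFail M T k₀ K (rotConfig i ω)ᶜ})) :=
        measureReal_mono hsub (measure_ne_top _ _)
    _ ≤ ∑ i ∈ Finset.range 6, μ.real ({ω | OutFail M T k₀ K (rotConfig i ω)} ∪ {ω | OutFail M T k₀ K (rotConfig i ω)ᶜ}) :=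
        measureReal_biUnion_finset_le _ _
    _ ≤ ∑ i ∈ Finset.range 6, 2 * μ.real {χ | OutFail M T k₀ K χ} := by
        refine Finset.sum_le_sum fun i _ => ?_
        refine (measureReal_union_le _ _).trans ?_
        rw [hμ, real_setOf_outFail_rotConfig, real_setOf_outFail_rotConfig_compl]
        linarith
    _ = 12 * μ.real {χ | OutFail M T k₀ K χ} := by
        rw [Finset.sum_const, Finset.card_range, nsmul_eq_mul]; ring

/-- **`P_{1/2}(¬ OutGood) ≤ 12 ((1 - c₄)^{T+1} + T (1 - c_F²)^K)`** — the "`(4δ)`" of Nolin's first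
step, small once `T` and then `K` are large. [cite: Nolin2008, §4.4 (arXiv 0711.4948: proof of Thm. 10, first step)] -/
theorem real_setOf_not_outGood_le {cF c₄ : ℝ} (hcF : 0 < cF)
    (hF : ∀ (z : Site 2) (k : ℕ), 1 ≤ k → cF ≤ (triSitePercolation half).real (triFrameAt z k))
    (hrsw : ∀ n : ℕ, 1 ≤ ⌊(4 : ℝ) * n⌋₊ → c₄ ≤ triLRCrossingProb half ⌊(4 : ℝ) * n⌋₊ n)
    {M T k₀ K : ℕ} (hM : 3 ≤ M) (hk₀ : 1 ≤ k₀) (hKM : ∀ j < K, 16 * (trapScale k₀ j : ℤ) + 1 ≤ M) :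
    (triSitePercolation half).real {ω | ¬ OutGood M T k₀ K ω} ≤ 12 * ((1 - c₄) ^ (T + 1) + T * (1 - cF ^ 2) ^ K) :=
  (real_setOf_not_outGood_le_mul M T k₀ K).trans
    (mul_le_mul_of_nonneg_left (real_setOf_outFail_le hcF hF hrsw hM hk₀ hKM) (by norm_num))

/-! ### Locality: the failure events live outside `Λ_M` -/

/-- The sites read by `OutFail` behind side `0`: the trapezoid and the squares of half-width `R`
about the sites of the outer side. [folklore] -/
def outFailFinset (M R : ℕ) : Finset (Site 2) := trapD M ∪ (trapO M).biUnion fun z => triSquareFinset z R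

/-- Sites of `outFailFinset` have first coordinate `> M` when `R < M`. [folklore] -/
theorem lt_apply_zero_of_mem_outFailFinset {M R : ℕ} (hRM : R < M) {v : Site 2} (hv : v ∈ outFailFinset M R) :
    (M : ℤ) < v 0 := by
  rw [outFailFinset, Finset.mem_union, Finset.mem_biUnion] at hv
  rcases hv with hv | ⟨z, hz, hv⟩
  · exact (mem_trapD.1 hv).1
  · have hz' := trapO_coord hz
    rw [mem_triSquareFinset] at hv
    have : (R : ℤ) < M := by exact_mod_cast hRM
    omega

/-- Sites with first coordinate `> M` have norm `> M`. [folklore] -/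
theorem lt_triNorm_of_lt_apply_zero {M : ℕ} {v : Site 2} (hv : (M : ℤ) < v 0) : (M : ℤ) < triNorm v := by
  rw [triNorm_eq_max]; simp only [lt_max_iff]; exact Or.inl (Or.inl hv)

/-- Congruence of the exploration sequence: configurations agreeing on the trapezoid have the same
exploration sequences (`JDomain.lowestSeq_congr`). [cite: KestenPTM1982, §2.3 Prop. 2.3] -/
theorem lowestSeq_eq_of_agree {M : ℕ} (hM : 1 ≤ M) {ω ω' : Set (Site 2)}
    (h : ∀ v ∈ trapD M, v ∈ ω ↔ v ∈ ω') (u : ℕ) :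
    (trapDomain M).lowestSeq ω u = (trapDomain M).lowestSeq ω' u := by
  have hcut := trapDomain_cutProp M
  have hdual := trapDomain_dualProp hM
  have key : ∀ (χ χ' : Set (Site 2)), (∀ v ∈ trapD M, v ∈ χ ↔ v ∈ χ') → ∀ p,
      (trapDomain M).lowestSeq χ u = some p → (trapDomain M).lowestSeq χ' u = some p := by
    rintro χ χ' hχ ⟨c, z⟩ hp
    exact (JDomain.lowestSeq_congr hcut hdual fun v hv =>
      hχ v (JDomain.lower_subset_D (JDomain.isCrossing_of_lowestSeq hp).1.subset hv)).1 hp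
  cases hω : (trapDomain M).lowestSeq ω u with
  | some p => exact (key ω ω' h p hω).symm
  | none =>
    cases hω' : (trapDomain M).lowestSeq ω' u with
    | none => rfl
    | some p =>
      have := key ω' ω (fun v hv => (h v hv).symm) p hω'
      rw [hω] at this
      exact absurd this (by simp)

/-- Agreement on a superset of `S` makes the `S`-parts of two configurations equal. [folklore] -/
theorem inter_eq_inter_of_agree {S F : Set (Site 2)} {ω ω' : Set (Site 2)} (hSF : S ⊆ F)
    (h : ∀ v ∈ F, v ∈ ω ↔ v ∈ ω') : S ∩ ω = S ∩ ω' := by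
  ext v
  exact ⟨fun hv => ⟨hv.1, (h v (hSF hv.1)).1 hv.2⟩, fun hv => ⟨hv.1, (h v (hSF hv.1)).2 hv.2⟩⟩

/-- Congruence of the per-scale success event: it only reads the trapezoid and the square of
half-width `2k + 1` about the tip. [folklore] -/
theorem trapFenceOK_iff_of_agree {M R : ℕ} {c : Finset (Site 2)} {z : Site 2} {k : ℕ} (hz : z ∈ trapO M)
    (hkR : 2 * k + 1 ≤ R) {ω ω' : Set (Site 2)} (h : ∀ v ∈ (↑(outFailFinset M R) : Set (Site 2)), v ∈ ω ↔ v ∈ ω') :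
    TrapFenceOK M c z k ω ↔ TrapFenceOK M c z k ω' := by
  have hkR' : 2 * (k : ℤ) + 1 ≤ R := by exact_mod_cast hkR
  have hsq : ∀ v : Site 2, z 0 - (2 * k + 1) ≤ v 0 → v 0 ≤ z 0 + (2 * k + 1) → z 1 - (2 * k + 1) ≤ v 1 → v 1 ≤ z 1 + (2 * k + 1) →
      v ∈ (↑(outFailFinset M R) : Set (Site 2)) := by
    intro v h1 h2 h3 h4
    rw [Finset.mem_coe, outFailFinset, Finset.mem_union, Finset.mem_biUnion]
    refine Or.inr ⟨z, hz, ?_⟩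
    rw [mem_triSquareFinset]; omega
  have hD : (↑(trapD M) : Set (Site 2)) ⊆ ↑(outFailFinset M R) := by
    intro v hv
    rw [Finset.mem_coe, outFailFinset, Finset.mem_union]
    exact Or.inl (Finset.mem_coe.1 hv)
  have h1 : triStrip (z 0 + k) (z 1 + k) k k ∩ ω = triStrip (z 0 + k) (z 1 + k) k k ∩ ω' :=
    inter_eq_inter_of_agree (fun v hv => by rw [mem_triStrip] at hv; exact hsq v (by omega) (by omega) (by omega) (by omega)) h
  have h2 : trapFrameZone M z k ∩ ω = trapFrameZone M z k ∩ ω' :=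
    inter_eq_inter_of_agree (fun v hv => by
      rw [mem_trapFrameZone] at hv; exact hsq v hv.2.1 hv.2.2.1 hv.2.2.2.1 hv.2.2.2.2) h
  have h3 : (↑(trapD M) : Set (Site 2)) ∩ ωᶜ = ↑(trapD M) ∩ ω'ᶜ :=
    inter_eq_inter_of_agree hD fun v hv => not_congr (h v hv)
  unfold TrapFenceOK OpenVCrossThrough
  rw [h1, h2, h3]

/-- **Locality of `OutFail`**: configurations agreeing on `outFailFinset M R` fail together
(`1 ≤ M`, `2 k_j + 1 ≤ R` for all scales). [cite: Nolin2008, §4.4 (arXiv 0711.4948: proof of Thm. 10, "by independence")] -/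
theorem outFail_iff_of_agree {M T k₀ K R : ℕ} (hM : 1 ≤ M) (hR : ∀ j < K, 2 * trapScale k₀ j + 1 ≤ R)
    {ω ω' : Set (Site 2)} (h : ∀ v ∈ (↑(outFailFinset M R) : Set (Site 2)), v ∈ ω ↔ v ∈ ω') :
    OutFail M T k₀ K ω ↔ OutFail M T k₀ K ω' := by
  have hD : ∀ v ∈ trapD M, v ∈ ω ↔ v ∈ ω' := fun v hv => h v (by
    rw [Finset.mem_coe, outFailFinset, Finset.mem_union]; exact Or.inl hv)
  have hseq := lowestSeq_eq_of_agree hM hD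
  unfold OutFail TrapSeqFail
  rw [hseq T]
  refine or_congr Iff.rfl (exists_congr fun u => and_congr Iff.rfl ?_)
  rw [hseq u]
  refine exists_congr fun c => exists_congr fun z => and_congr_right fun hcz => ?_
  have hz : z ∈ trapO M := (JDomain.isCrossing_of_lowestSeq hcz).1.tip_mem_J
  exact forall_congr' fun j => forall_congr' fun hj => not_congr (trapFenceOK_iff_of_agree hz (hR j hj) h)

/-- **`OutFail` is determined by `outFailFinset M R`.** [cite: Nolin2008, §4.4 (arXiv 0711.4948: proof of Thm. 10, "by independence")] -/
theorem determinedBy_setOf_outFail {M T k₀ K R : ℕ} (hM : 1 ≤ M) (hR : ∀ j < K, 2 * trapScale k₀ j + 1 ≤ R) :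
    DeterminedBy {χ : SiteConfig (Site 2) | OutFail M T k₀ K χ} ↑(outFailFinset M R) := by
  rw [determinedBy_iff]
  intro ω ω' hωω'
  exact outFail_iff_of_agree hM hR fun v hv => by
    have := Set.ext_iff.1 hωω' v
    simp only [Set.mem_inter_iff] at this
    exact ⟨fun h1 => (this.1 ⟨h1, hv⟩).1, fun h2 => (this.2 ⟨h2, hv⟩).1⟩

/-- The sites read by `OutGood`: the six rotated copies of `outFailFinset M R`. [folklore] -/
def outGoodFinset (M R : ℕ) : Finset (Site 2) :=
  (Finset.range 6).biUnion fun i => (outFailFinset M R).image (triRotIsoPow i)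

/-- **All sites read by `OutGood` have norm `> M`** (`R < M`): the event is independent of
everything inside `Λ_M`. [cite: Nolin2008, §4.4 (arXiv 0711.4948: proof of Thm. 10, "by independence")] -/
theorem lt_triNorm_of_mem_outGoodFinset {M R : ℕ} (hRM : R < M) {v : Site 2} (hv : v ∈ outGoodFinset M R) :
    (M : ℤ) < triNorm v := by
  rw [outGoodFinset, Finset.mem_biUnion] at hv
  obtain ⟨i, -, hv⟩ := hv
  rw [Finset.mem_image] at hv
  obtain ⟨w, hw, rfl⟩ := hv
  rw [triNorm_rot]
  exact lt_triNorm_of_lt_apply_zero (lt_apply_zero_of_mem_outFailFinset hRM hw)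

/-- `outGoodFinset` is disjoint from the ball `Λ_M`. [folklore] -/
theorem disjoint_outGoodFinset_triBall {M R : ℕ} (hRM : R < M) : Disjoint (outGoodFinset M R) (triBall M) := by
  rw [Finset.disjoint_left]
  intro v hv hvB
  have h1 := lt_triNorm_of_mem_outGoodFinset hRM hv
  have h2 := mem_triBall_iff.1 hvB
  omega

/-- Failure in the `i`-th frame is determined by the `i`-th rotated copy of `outFailFinset`. [folklore] -/
theorem determinedBy_setOf_outFail_rotConfig {M T k₀ K R : ℕ} (hM : 1 ≤ M) (hR : ∀ j < K, 2 * trapScale k₀ j + 1 ≤ R) (i : ℕ) :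
    DeterminedBy {ω : SiteConfig (Site 2) | OutFail M T k₀ K (rotConfig i ω)} (triRotIsoPow i '' ↑(outFailFinset M R)) :=
  determinedBy_preimage_rotConfig i (determinedBy_setOf_outFail hM hR)

/-- Failure of the complementary colour in the `i`-th frame is determined by the same sites. [folklore] -/
theorem determinedBy_setOf_outFail_rotConfig_compl {M T k₀ K R : ℕ} (hM : 1 ≤ M) (hR : ∀ j < K, 2 * trapScale k₀ j + 1 ≤ R)
    (i : ℕ) :
    DeterminedBy {ω : SiteConfig (Site 2) | OutFail M T k₀ K (rotConfig i ω)ᶜ} (triRotIsoPow i '' ↑(outFailFinset M R)) := by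
  have hset : {ω : SiteConfig (Site 2) | OutFail M T k₀ K (rotConfig i ω)ᶜ} =
      rotConfig i ⁻¹' {χ : Set (Site 2) | χᶜ ∈ {χ' : SiteConfig (Site 2) | OutFail M T k₀ K χ'}} := by
    ext ω; simp only [Set.mem_setOf_eq, Set.mem_preimage]
  rw [hset]
  exact determinedBy_preimage_rotConfig i (determinedBy_compl_mem (determinedBy_setOf_outFail hM hR))

/-- **`OutGood` is determined by `outGoodFinset M R`** — finitely many sites, all outside `Λ_M`
(`lt_triNorm_of_mem_outGoodFinset`). [cite: Nolin2008, §4.4 (arXiv 0711.4948: proof of Thm. 10, "by independence")] -/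
theorem determinedBy_setOf_outGood {M T k₀ K R : ℕ} (hM : 1 ≤ M) (hR : ∀ j < K, 2 * trapScale k₀ j + 1 ≤ R) :
    DeterminedBy {ω : SiteConfig (Site 2) | OutGood M T k₀ K ω} ↑(outGoodFinset M R) := by
  have hsub : ∀ i < 6, triRotIsoPow i '' (↑(outFailFinset M R) : Set (Site 2)) ⊆ ↑(outGoodFinset M R) := by
    intro i hi v hv
    obtain ⟨w, hw, rfl⟩ := hv
    rw [Finset.mem_coe, outGoodFinset, Finset.mem_biUnion]
    exact ⟨i, Finset.mem_range.2 hi, Finset.mem_image.2 ⟨w, hw, rfl⟩⟩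
  rw [determinedBy_iff]
  intro ω ω' hωω'
  simp only [Set.mem_setOf_eq, OutGood]
  refine forall_congr' fun i => forall_congr' fun hi6 => ?_
  have k1 := (determinedBy_iff _ _).1 ((determinedBy_setOf_outFail_rotConfig (T := T) hM hR i).mono (hsub i hi6)) ω ω' hωω'
  have k2 := (determinedBy_iff _ _).1 ((determinedBy_setOf_outFail_rotConfig_compl (T := T) hM hR i).mono (hsub i hi6)) ω ω' hωω'
  simp only [Set.mem_setOf_eq] at k1 k2
  rw [k1, k2]

/-- The complement form: `{¬ OutGood}` is determined by `outGoodFinset M R`. [folklore] -/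
theorem determinedBy_setOf_not_outGood {M T k₀ K R : ℕ} (hM : 1 ≤ M) (hR : ∀ j < K, 2 * trapScale k₀ j + 1 ≤ R) :
    DeterminedBy {ω : SiteConfig (Site 2) | ¬ OutGood M T k₀ K ω} ↑(outGoodFinset M R) :=
  (determinedBy_setOf_outGood hM hR).compl

/-- **Independence from the inside**: for an event `A` determined by the sites of `Λ_M` (such as
an arm event `armEvent κ n M`), `P(A ∩ {¬ OutGood}) = P(A) · P(¬ OutGood)` (`R < M`). [cite: Nolin2008, §4.4 (arXiv 0711.4948: proof of Thm. 10, "by independence")] -/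
theorem real_inter_setOf_not_outGood {M T k₀ K R : ℕ} (hM : 1 ≤ M) (hR : ∀ j < K, 2 * trapScale k₀ j + 1 ≤ R)
    (hRM : R < M) {A : Set (SiteConfig (Site 2))} (hA : DeterminedBy A ↑(triBall M)) :
    (triSitePercolation half).real (A ∩ {ω | ¬ OutGood M T k₀ K ω}) =
      (triSitePercolation half).real A * (triSitePercolation half).real {ω | ¬ OutGood M T k₀ K ω} := by
  unfold triSitePercolation
  exact sitePercolation_real_inter_of_disjoint half hA (determinedBy_setOf_not_outGood hM hR)
    (disjoint_outGoodFinset_triBall hRM).symm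

end Literature.Probability.Percolation
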